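import Mathlib
import HarnessLib
import Summits.HubbardSuperconductivity.HubbardSuperconductivity.Theorems.KLProgrammeKLRegimeSplitTwoLegCoreTDTube

/-!
# Route `KLProgramme` — GEN-6 ENGINE (`KLRegimeEngineV16`, stmt-HubbardSuperconductivity-20236), two-leg stubs: PROFILE-KEYED `TwoLegCoreTD` closers

Cell `gate-hubbard-kl`, seat p1b (g7).  Interface defect (D3) (p2 g10 / pen l.2378, against p516528 `…TwoLegCoreTDTube`): keying tier-1 j = 2 on the FULL momentum
Hessian of the reading function, and the (E3c) near regime on its full gradient, asks for NORMAL derivatives that cost `Λ_n⁻¹` per order, while the slot's budgets are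
those of the ANGULAR data the piece actually carries (`ℓ_n = klFrameExtFn μ δ_n`, `δ_{n+1} = ν_{n+1}(K) − ν_n(K)`, `δ₀ = ν₀(K) − K∘k_F^K`).  So here: (E3a) from the
angular jets `|δ| ≤ A 0`, `|δ′| ≤ A 1`, `|δ″| ≤ A 2` (`norm_iteratedFDeriv_onM_piece_le_of_angularJets`, n-free chain rule `norm_iteratedFDeriv_onM_piece_le`); (E3c)
NEAR from the PROFILE RESPONSE at fixed angle `|δ^K(θ) − δ^{K′}(θ)| ≤ ρ·frameDist K K′` (no point-motion/response split — to leading order those two cancel), FAR from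
value sizes, fits `ρ ≤ lipBar`, `2·A 0 ≤ lipBar·d` (`frameLipschitzFnTD_zero/succ_of_profileNearFar`); (E3e) as in `…TwoLegCoreTDTube` (shell-tube gradient of
`I_L[σ_n − K∘p]`, a normal slope with budget `cz|U|`: `twoLegSlopes_of_sepTubeGradient`).  Closers `twoLegCoreTD_zero/succ_of_profileData` (named thresholds) and the
registered-binder twins `…_stub8` (`U ≤ klEngU₀4`, `klEngGeo5`, `klEngQ5 P R`).  Proofs only; nothing about the model is asserted.
References: BGM 2006 §2.4 (2.36) [cite: BenfattoGiulianiMastropietro2006]; FST IV §1 (loss of derivatives).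
-/

noncomputable section

namespace Summit.HubbardSuperconductivity.HubbardSuperconductivity.Theorems.KLRegimeSplit

set_option linter.dupNamespace false -- summit = problem name (single-conjunct summit), D-0017

open Real Finset
open Literature.MathematicalPhysics.QuantumLattice Literature.MathematicalPhysics.QuantumLattice.BandSectorCounting
open Literature.Probability.LatticeModels
open Summit.HubbardSuperconductivity.HubbardSuperconductivity.Theorems.DispersionFlow
open Summit.HubbardSuperconductivity.HubbardSuperconductivity.Theorems.PerturbedFermiCurve
open Summit.HubbardSuperconductivity.HubbardSuperconductivity.Theorems.KLProgrammeLegKernels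
open Summit.HubbardSuperconductivity.HubbardSuperconductivity.Theorems.TwoLegFourier
open Summit.HubbardSuperconductivity.HubbardSuperconductivity.Theorems.EngineV8

variable {L M : ℕ} [NeZero L] [NeZero M]

/-! ## §1 (E3a) tier 1 of a G-extended piece from the ANGULAR JETS of its profile -/

/-- **Tier-1 sizes (j ≤ 2) of a G-extended piece `P = klFrameExtFn μ δ` from the angular jets of the profile**: `|δ| ≤ A 0`, `|δ′| ≤ A 1`, `|δ″| ≤ A 2`
(δ `C⁴`, `2π`-periodic, `μ ∈ klWindowC`) ⇒ `‖Dʲ(onM P) q‖ ≤ [j=0]·A 0 + (j!)²(2·j!·X·200ʲ)·G_j·(4 + max 1 ((j−1)!/(8/5)))ʲ` with `G₀ = 2·A 0`, `G₁ = (2π+1)·A 1`,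
`G₂ = (2π+1)·A 1 + A 2` — n-free constants; no momentum derivative of any reading function enters. -/
theorem norm_iteratedFDeriv_onM_piece_le_of_angularJets {δ : ℝ → ℝ} {P : FrameFn} {μ : ℝ} (hP : P = klFrameExtFn μ δ) (hδc : ContDiff ℝ 4 δ)
    (hper : Function.Periodic δ (2 * π)) (hμ : μ ∈ klWindowC) {A : ℕ → ℝ}
    (hA0 : ∀ θ, |δ θ| ≤ A 0) (hA1 : ∀ θ, |deriv δ θ| ≤ A 1) (hA2 : ∀ θ, |iteratedDeriv 2 δ θ| ≤ A 2)
    {j : ℕ} (hj : j ≤ 2) {X : ℝ} (hX : ∀ l ≤ j, ∀ x : ℝ, ‖iteratedFDeriv ℝ l salmhoferCutoff x‖ ≤ X) (q : Momentum) :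
    ‖iteratedFDeriv ℝ j (onM P) q‖ ≤
      (if j = 0 then A 0 else 0) +
        (j.factorial : ℝ) ^ 2 * (2 * j.factorial * X * 200 ^ j) *
          (if j = 0 then 2 * A 0 else (2 * π + 1) * A 1 + (if j = 2 then A 2 else 0)) *
          (4 + max 1 (((j - 1).factorial : ℝ) / (8 / 5))) ^ j := by
  have hdiff : Differentiable ℝ δ := hδc.differentiable (by norm_num)
  have hmean : |klAngularMean δ| ≤ A 0 := abs_klAngularMean_le' hA0
  have hosc : ∀ t, |δ t - klAngularMean δ| ≤ 2 * π * A 1 := fun t => abs_sub_klAngularMean_le_of_deriv hdiff hper hA1 t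
  have hB1 : 0 ≤ A 1 := (abs_nonneg _).trans (hA1 0)
  have hB2 : 0 ≤ A 2 := (abs_nonneg _).trans (hA2 0)
  have hcd : ∀ i ≤ 2, ∀ t, 1 ≤ i → iteratedFDeriv ℝ i (fun t => δ t - klAngularMean δ) t = iteratedFDeriv ℝ i δ t := by
    intro i hi t hi1
    rw [fun_iteratedFDeriv_sub_apply (hδc.contDiffAt.of_le (by exact_mod_cast hi.trans (by norm_num))) contDiffAt_const,
      iteratedFDeriv_const_of_ne (by omega), Pi.zero_apply, sub_zero]
  have hG0 : ∀ t, ‖iteratedFDeriv ℝ 0 (fun t => δ t - klAngularMean δ) t‖ ≤ 2 * A 0 := fun t => by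
    rw [norm_iteratedFDeriv_zero, Real.norm_eq_abs]
    have := abs_sub (δ t) (klAngularMean δ); have := hA0 t; linarith
  have hG0' : ∀ t, ‖iteratedFDeriv ℝ 0 (fun t => δ t - klAngularMean δ) t‖ ≤ (2 * π + 1) * A 1 := fun t => by
    rw [norm_iteratedFDeriv_zero, Real.norm_eq_abs]; have := hosc t; nlinarith
  have hG1 : ∀ t, ‖iteratedFDeriv ℝ 1 (fun t => δ t - klAngularMean δ) t‖ ≤ (2 * π + 1) * A 1 := fun t => by
    rw [hcd 1 (by norm_num) t le_rfl, norm_iteratedFDeriv_eq_norm_iteratedDeriv, iteratedDeriv_one, Real.norm_eq_abs]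
    have := hA1 t; nlinarith [Real.pi_pos]
  have hG2 : ∀ t, ‖iteratedFDeriv ℝ 2 (fun t => δ t - klAngularMean δ) t‖ ≤ A 2 := fun t => by
    rw [hcd 2 le_rfl t (by norm_num), norm_iteratedFDeriv_eq_norm_iteratedDeriv, Real.norm_eq_abs]; exact hA2 t
  have key : ∀ {G : ℝ}, (∀ i ≤ j, ∀ t : ℝ, ‖iteratedFDeriv ℝ i (fun t => δ t - klAngularMean δ) t‖ ≤ G) →
      ‖iteratedFDeriv ℝ j (onM P) q‖ ≤
        (if j = 0 then A 0 else 0) +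
          (j.factorial : ℝ) ^ 2 * (2 * j.factorial * X * 200 ^ j) * G * (4 + max 1 (((j - 1).factorial : ℝ) / (8 / 5))) ^ j := by
    intro G hG
    have hmain := norm_iteratedFDeriv_onM_piece_le hP (N := 4) hδc hper (j := j) (by exact_mod_cast hj.trans (by norm_num)) hμ hG hX q
    refine hmain.trans (add_le_add ?_ le_rfl)
    split_ifs
    · exact hmean
    · exact le_rfl
  rcases Nat.lt_or_ge j 1 with hj0 | hj1
  · have hj0' : j = 0 := by omega
    subst hj0'
    simp only [if_true] at key ⊢
    exact key fun i hi t => by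
      have hi0 : i = 0 := by omega
      subst hi0; exact hG0 t
  · have hjne : j ≠ 0 := by omega
    rcases Nat.lt_or_ge j 2 with hj1' | hj2
    · have hj1'' : j = 1 := by omega
      subst hj1''
      simp only [if_neg one_ne_zero, show (1 : ℕ) ≠ 2 by norm_num, if_false, add_zero] at key ⊢
      exact key fun i hi t => by
        rcases Nat.eq_zero_or_pos i with rfl | hipos
        · exact hG0' t
        · have hi1 : i = 1 := by omega
          subst hi1; exact hG1 t
    · have hj2' : j = 2 := by omega
      subst hj2'
      simp only [show (2 : ℕ) ≠ 0 by norm_num, if_false, if_true] at key ⊢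
      exact key fun i hi t => by
        rcases Nat.eq_zero_or_pos i with rfl | hipos
        · exact (hG0' t).trans (le_add_of_nonneg_right hB2)
        · rcases (show i = 1 ∨ i = 2 by omega) with rfl | rfl
          · exact (hG1 t).trans (le_add_of_nonneg_right hB2)
          · exact (hG2 t).trans (le_add_of_nonneg_left (by positivity))

/-! ## §2 (E3c) from PROFILE RESPONSES (near) and value sizes (far) -/

section Profiles

variable {a b : ℝ} (B : BandBounds a b) {K K' : TrigPolyC4v} {A : ℝ}
  (hA : ∀ p : Momentum, ∀ j ≤ 2, ‖iteratedFDeriv ℝ j (frameShift K) p‖ ≤ A)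
  (hA' : ∀ p : Momentum, ∀ j ≤ 2, ‖iteratedFDeriv ℝ j (frameShift K') p‖ ≤ A)
  (hADt : 2 * A < B.Dtmin) {μ : ℝ} (hlo : a ≤ μ - A) (hhi : μ + A ≤ b)
include B hA hA' hADt hlo hhi

/-- Scale `0`: a uniform bound on the profile difference bounds the piece difference. -/
theorem abs_klTwoLegPieceFn_eval_zero_sub_le_of_profiles {β U ε : ℝ}
    (h : ∀ θ : ℝ, |(klLocalPart L M β U μ K 0 θ - K.eval (klFermiPoint μ K θ)) -
      (klLocalPart L M β U μ K' 0 θ - K'.eval (klFermiPoint μ K' θ))| ≤ ε) (q : Fin 2 → ℝ) :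
    |klTwoLegPieceFn L M β U μ K.eval 0 q - klTwoLegPieceFn L M β U μ K'.eval 0 q| ≤ ε := by
  obtain ⟨hcK, hcKc⟩ := continuous_klLocalPart_and_frameOnCurve B hA hADt hlo hhi (K := K) (L := L) (M := M) β U 0
  obtain ⟨hcK', hcK'c⟩ := continuous_klLocalPart_and_frameOnCurve B hA' hADt hlo hhi (K := K') (L := L) (M := M) β U 0
  rw [klTwoLegPieceFn_eval_zero β U μ K hcK hcKc, klTwoLegPieceFn_eval_zero β U μ K' hcK' hcK'c]
  exact abs_klFrameExtFn_sub_klFrameExtFn_le μ ((hcK.sub hcKc).intervalIntegrable _ _) ((hcK'.sub hcK'c).intervalIntegrable _ _) h q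

/-- Scale `n + 1`: a uniform bound on the increment-profile difference bounds the piece difference. -/
theorem abs_klTwoLegPieceFn_eval_succ_sub_le_of_profiles {β U ε : ℝ} {n : ℕ}
    (h : ∀ θ : ℝ, |(klLocalPart L M β U μ K (n + 1) θ - klLocalPart L M β U μ K n θ) -
      (klLocalPart L M β U μ K' (n + 1) θ - klLocalPart L M β U μ K' n θ)| ≤ ε) (q : Fin 2 → ℝ) :
    |klTwoLegPieceFn L M β U μ K.eval (n + 1) q - klTwoLegPieceFn L M β U μ K'.eval (n + 1) q| ≤ ε := by
  have hc1 := (continuous_klLocalPart_and_frameOnCurve B hA hADt hlo hhi (K := K) (L := L) (M := M) β U (n + 1)).1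
  have hc0 := (continuous_klLocalPart_and_frameOnCurve B hA hADt hlo hhi (K := K) (L := L) (M := M) β U n).1
  have hc1' := (continuous_klLocalPart_and_frameOnCurve B hA' hADt hlo hhi (K := K') (L := L) (M := M) β U (n + 1)).1
  have hc0' := (continuous_klLocalPart_and_frameOnCurve B hA' hADt hlo hhi (K := K') (L := L) (M := M) β U n).1
  rw [klTwoLegPieceFn_eval_succ β U μ K n hc1 hc0, klTwoLegPieceFn_eval_succ β U μ K' n hc1' hc0']
  exact abs_klFrameExtFn_sub_klFrameExtFn_le μ ((hc1.sub hc0).intervalIntegrable _ _) ((hc1'.sub hc0').intervalIntegrable _ _) h q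

end Profiles

/-- **CAPPED (E3c) FOR `ℓ_0` FROM PROFILE RESPONSES.**  Near capped comparison frames (`frameDist K K′ ≤ d`): the profile response at fixed angle
`|δ₀^K(θ) − δ₀^{K′}(θ)| ≤ ρ·frameDist K K′` (`δ₀^X(θ) = ν₀(X)(θ) − X(k_F^X θ)`); far ones: value sizes `v` of both profiles; `0 < d`; fits `ρ ≤ lipBar G Q U 0`,
`2v ≤ lipBar G Q U 0 · d` ⇒ `FrameLipschitzFnTD L M hist G Q R β U μ K 0`. -/
theorem frameLipschitzFnTD_zero_of_profileNearFar {R : RenConsts} (hR : ∀ j, 0 ≤ R.Gfr j) {c : ℝ} (hc : 0 < c)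
    (hcle : c ≤ klCurveC3 R) {U : ℝ} (hU : 0 < U) (hUle : U ≤ klCurveU0 R) {β : ℝ} (hβmin : klBetaMin ≤ β)
    (hβc : β ≤ Real.exp (c / U ^ 2)) {μ : ℝ} (hμ : μ ∈ klWindowC) {K : TrigPolyC4v} (hK : FrameOK R U (nScales β) μ K)
    (hist : TrigPolyC4v → ℕ → Prop) (G : GeoConsts) (Q : EngConsts) {d ρ v : ℝ} (hd : 0 < d)
    (hnear : ∀ K' : TrigPolyC4v, FrameOKDeg R U (klTempScaleIdx β klE0) μ K' → frameDist K K' ≤ d → ∀ θ : ℝ,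
      |(klLocalPart L M β U μ K 0 θ - K.eval (klFermiPoint μ K θ)) - (klLocalPart L M β U μ K' 0 θ - K'.eval (klFermiPoint μ K' θ))| ≤
        ρ * frameDist K K')
    (hvK : ∀ θ : ℝ, |klLocalPart L M β U μ K 0 θ - K.eval (klFermiPoint μ K θ)| ≤ v)
    (hvK' : ∀ K' : TrigPolyC4v, FrameOKDeg R U (klTempScaleIdx β klE0) μ K' → ∀ θ : ℝ,
      |klLocalPart L M β U μ K' 0 θ - K'.eval (klFermiPoint μ K' θ)| ≤ v)
    (hfit : ρ ≤ lipBar G Q U 0) (hfar : 2 * v ≤ lipBar G Q U 0 * d) :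
    FrameLipschitzFnTD L M hist G Q R β U μ K 0 := by
  intro K' hK' _ q
  obtain ⟨ha, hab, hb⟩ : (-4 : ℝ) < -1.1 ∧ (-1.1 : ℝ) ≤ -0.1 ∧ (-0.1 : ℝ) < 0 := by norm_num
  obtain ⟨hAf, -, hADt, -, ⟨hlo, hhi⟩, -, -⟩ := frame_sizes_of_frameOK_explicit hR hc hcle hU hUle hβmin hβc hμ hK
  obtain ⟨hAf', -, -, -, -, -, -⟩ := frame_sizes_of_frameOK_explicit hR hc hcle hU hUle hβmin hβc hμ hK'.1
  have hfd : 0 ≤ frameDist K K' := frameDist_nonneg K K'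
  have hv0 : 0 ≤ v := (abs_nonneg _).trans (hvK 0)
  have hlip : 0 ≤ lipBar G Q U 0 := by nlinarith
  refine abs_klTwoLegPieceFn_eval_zero_sub_le_of_profiles (bandBounds ha hab hb) hAf hAf' hADt hlo hhi (L := L) (M := M) (fun θ => ?_) q
  rcases le_or_gt (frameDist K K') d with hnearK | hfarK
  · exact (hnear K' hK' hnearK θ).trans (mul_le_mul_of_nonneg_right hfit hfd)
  · calc _ ≤ v + v := (abs_sub _ _).trans (add_le_add (hvK θ) (hvK' K' hK' θ))
      _ = 2 * v := by ring
      _ ≤ lipBar G Q U 0 * d := hfar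
      _ ≤ lipBar G Q U 0 * frameDist K K' := mul_le_mul_of_nonneg_left hfarK.le hlip

/-- **CAPPED (E3c) AT SCALE `n + 1` FROM PROFILE RESPONSES.**  Near capped comparison frames with history: the increment-profile response at fixed angle
`|(ν_{n+1} − ν_n)(K)(θ) − (ν_{n+1} − ν_n)(K′)(θ)| ≤ ρ·frameDist K K′`; far ones: value sizes `v`; `0 < d`; fits `ρ ≤ lipBar G Q U (n+1)`, `2v ≤ lipBar G Q U (n+1)·d`
⇒ `FrameLipschitzFnTD L M hist G Q R β U μ K (n+1)`. -/
theorem frameLipschitzFnTD_succ_of_profileNearFar {R : RenConsts} (hR : ∀ j, 0 ≤ R.Gfr j) {c : ℝ} (hc : 0 < c)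
    (hcle : c ≤ klCurveC3 R) {U : ℝ} (hU : 0 < U) (hUle : U ≤ klCurveU0 R) {β : ℝ} (hβmin : klBetaMin ≤ β)
    (hβc : β ≤ Real.exp (c / U ^ 2)) {μ : ℝ} (hμ : μ ∈ klWindowC) {K : TrigPolyC4v} (hK : FrameOK R U (nScales β) μ K)
    (hist : TrigPolyC4v → ℕ → Prop) (G : GeoConsts) (Q : EngConsts) (n : ℕ) {d ρ v : ℝ} (hd : 0 < d)
    (hnear : ∀ K' : TrigPolyC4v, FrameOKDeg R U (klTempScaleIdx β klE0) μ K' → (∀ j < n + 1, hist K' j) → frameDist K K' ≤ d → ∀ θ : ℝ,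
      |(klLocalPart L M β U μ K (n + 1) θ - klLocalPart L M β U μ K n θ) -
        (klLocalPart L M β U μ K' (n + 1) θ - klLocalPart L M β U μ K' n θ)| ≤ ρ * frameDist K K')
    (hvK : ∀ θ : ℝ, |klLocalPart L M β U μ K (n + 1) θ - klLocalPart L M β U μ K n θ| ≤ v)
    (hvK' : ∀ K' : TrigPolyC4v, FrameOKDeg R U (klTempScaleIdx β klE0) μ K' → (∀ j < n + 1, hist K' j) → ∀ θ : ℝ,
      |klLocalPart L M β U μ K' (n + 1) θ - klLocalPart L M β U μ K' n θ| ≤ v)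
    (hfit : ρ ≤ lipBar G Q U (n + 1)) (hfar : 2 * v ≤ lipBar G Q U (n + 1) * d) :
    FrameLipschitzFnTD L M hist G Q R β U μ K (n + 1) := by
  intro K' hK' hh q
  obtain ⟨ha, hab, hb⟩ : (-4 : ℝ) < -1.1 ∧ (-1.1 : ℝ) ≤ -0.1 ∧ (-0.1 : ℝ) < 0 := by norm_num
  obtain ⟨hAf, -, hADt, -, ⟨hlo, hhi⟩, -, -⟩ := frame_sizes_of_frameOK_explicit hR hc hcle hU hUle hβmin hβc hμ hK
  obtain ⟨hAf', -, -, -, -, -, -⟩ := frame_sizes_of_frameOK_explicit hR hc hcle hU hUle hβmin hβc hμ hK'.1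
  have hfd : 0 ≤ frameDist K K' := frameDist_nonneg K K'
  have hv0 : 0 ≤ v := (abs_nonneg _).trans (hvK 0)
  have hlip : 0 ≤ lipBar G Q U (n + 1) := by nlinarith
  refine abs_klTwoLegPieceFn_eval_succ_sub_le_of_profiles (bandBounds ha hab hb) hAf hAf' hADt hlo hhi (L := L) (M := M) (fun θ => ?_) q
  rcases le_or_gt (frameDist K K') d with hnearK | hfarK
  · exact (hnear K' hK' hh hnearK θ).trans (mul_le_mul_of_nonneg_right hfit hfd)
  · calc _ ≤ v + v := (abs_sub _ _).trans (add_le_add (hvK θ) (hvK' K' hK' hh θ))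
      _ = 2 * v := by ring
      _ ≤ lipBar G Q U (n + 1) * d := hfar
      _ ≤ lipBar G Q U (n + 1) * frameDist K K' := mul_le_mul_of_nonneg_left hfarK.le hlip

/-! ## §3 The PROFILE-KEYED `TwoLegCoreTD` closers -/

/-- **(E3d/e) for a capped frame from the field strength and the shell-tube gradient of the K-separated reading** (`∇S_n = ∇I_L[σ_n − K∘p] − ∇δ_K` under the
cap): `m₁' + 4/3·Gfr₁U² ≤ cz|U|·cDtmin(−1.2)(−0.05)/2` ⇒ `TwoLegSlopes R … K n`. -/
theorem twoLegSlopes_of_sepTubeGradient {R : RenConsts} (hR : ∀ j, 0 ≤ R.Gfr j) {c : ℝ} (hc : 0 < c)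
    (hcle : c ≤ klCurveC3 R) {U : ℝ} (hU : 0 < U) (hUle : U ≤ klCurveU0 R) {β : ℝ} (hβmin : klBetaMin ≤ β)
    (hβc : β ≤ Real.exp (c / U ^ 2)) {μ : ℝ} (hμ : μ ∈ klWindowC) {K : TrigPolyC4v} (hKD : FrameOKDeg R U (nScales β) μ K)
    (hL : klEngL₃ β U ≤ L) (n : ℕ)
    (hz : ∀ k ∈ klShell L μ K n, |klFieldStrength L M β U μ K n k - 1| ≤ R.cz * |U|)
    {m₁' : ℝ}
    (hm₁' : ∀ q : Momentum, |frameLevel μ K q| ≤ klScale klE0 n →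
      ‖fderiv ℝ (evalM (symInterp L (fun p => klLocSelfEnergyRe L M β U μ K n p - K.eval (latticeMomentum L p)))) q‖ ≤ m₁')
    (hfit1 : m₁' + 4 / 3 * R.Gfr 1 * U ^ 2 ≤ R.cz * |U| * (cDtmin (-1.2) (-0.05) / 2)) :
    TwoLegSlopes L M R β U μ K n := by
  have hK : FrameOK R U (nScales β) μ K := hKD.1
  have hdeg : K.degree ≤ L / 2 := hKD.degree_le_half rfl hβmin hL
  obtain ⟨ha', hab, hb⟩ : (-4 : ℝ) < -1.1 ∧ (-1.1 : ℝ) ≤ -0.1 ∧ (-0.1 : ℝ) < 0 := by norm_num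
  obtain ⟨hAf, -, -, -, ⟨hlo, hhi⟩, -, -⟩ := frame_sizes_of_frameOK_explicit hR hc hcle hU hUle hβmin hβc hμ hK
  obtain ⟨haw, habw, hbw⟩ : (-4 : ℝ) < -1.2 ∧ (-1.2 : ℝ) ≤ -0.05 ∧ (-0.05 : ℝ) < 0 := by norm_num
  set B := bandBounds haw habw hbw with hBdef
  have hBD : B.Dtmin = cDtmin (-1.2) (-0.05) := rfl
  have hAfw : ∀ p : Momentum, ∀ j ≤ 2, ‖iteratedFDeriv ℝ j (frameShift K) p‖ ≤
      2 * R.Gfr 0 * |U| + 2 * R.Gfr 1 * U ^ 2 + R.Gfr 2 * (c / Real.log 4) := fun p j hj =>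
    norm_iteratedFDeriv_frameShift_le_of_frameOK_regime hR hc.le hβmin hβc hK p hj
  obtain ⟨hA20w, hADtw, hhalf⟩ := two_frameSize_lt_cDtmin_wide hR hc.le hcle hU hUle
  have hADt' : 2 * (2 * R.Gfr 0 * |U| + 2 * R.Gfr 1 * U ^ 2 + R.Gfr 2 * (c / Real.log 4)) < B.Dtmin := by rw [hBD]; exact hADtw
  obtain ⟨hloΛ, hhiΛ⟩ := klWindowC_shell_margin hμ hA20w (klScale_klE0_le_klE0 n)
  have h13 : 0 ≤ 4 / 3 * R.Gfr 1 * U ^ 2 := by have := hR 1; positivity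
  have hm0 : 0 ≤ m₁' := by
    have hq := hm₁' (WithLp.toLp 2 (klFermiPoint μ K 0)) (by
      rw [frameLevel_klFermiPoint (bandBounds ha' hab hb) hAf hlo hhi 0, abs_zero]; unfold klScale klE0; positivity)
    exact (norm_nonneg _).trans hq
  have hczU : 0 ≤ R.cz * |U| := by
    by_contra hneg
    have hneg' : R.cz * |U| < 0 := lt_of_not_ge hneg
    have : R.cz * |U| * (cDtmin (-1.2) (-0.05) / 2) < 0 := mul_neg_of_neg_of_pos hneg' (by linarith [cDtmin_wide_ge])
    linarith
  set bS : ℝ := m₁' + 4 / 3 * R.Gfr 1 * U ^ 2 with hbS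
  have hbS0 : 0 ≤ bS := by positivity
  have hgradS : ∀ q : Momentum, |frameLevel μ K q| ≤ klScale klE0 n →
      ‖fderiv ℝ (evalM (symInterp L (klLocSelfEnergyRe L M β U μ K n))) q‖ ≤ bS := fun q hq =>
    (norm_fderiv_evalM_symInterp_le_of_sep_at (L := L) (M := M) hdeg β U μ n q (hm₁' q hq)).trans
      (by rw [hbS]; linarith [norm_iteratedFDeriv_one_frameShift_le_of_frameOK hR hK q])
  have hb' : bS ≤ R.cz * |U| * (B.Dtmin - 2 * (2 * R.Gfr 0 * |U| + 2 * R.Gfr 1 * U ^ 2 + R.Gfr 2 * (c / Real.log 4))) :=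
    hfit1.trans (mul_le_mul_of_nonneg_left (by rw [hBD]; exact hhalf) hczU)
  exact twoLegSlopes_of_fieldStrength_of_tubeGradient B hAfw hADt' hloΛ hhiΛ (selfEnergySymmetric_all L M β U μ K n) hz hbS0 hgradS hb'


/-- **`TwoLegCoreTD hist G P Q R … K 0` FROM PROFILE DATA** (named thresholds): angular jets `A 0, A 1, A 2` of `δ₀ = ν₀(K) − K∘k_F^K` with the tier-1 fits;
near profile responses `ρ` + value sizes `A 0` of every capped comparison frame, `0 < d`, `ρ ≤ lipBar G Q U 0`, `2·A 0 ≤ lipBar G Q U 0·d`; (E3d) on the shell and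
the gradient `m₁'` of `I_L[σ₀ − K∘p]` on the shell tube with `m₁' + 4/3·Gfr₁U² ≤ cz|U|·cDtmin/2`. -/
theorem twoLegCoreTD_zero_of_profileData {R : RenConsts} (hR : ∀ j, 0 ≤ R.Gfr j) {c : ℝ} (hc : 0 < c)
    (hcle : c ≤ klCurveC3 R) {U : ℝ} (hU : 0 < U) (hUle : U ≤ klCurveU0 R) {β : ℝ} (hβmin : klBetaMin ≤ β)
    (hβc : β ≤ Real.exp (c / U ^ 2)) {μ : ℝ} (hμ : μ ∈ klWindowC) {K : TrigPolyC4v} (hKD : FrameOKDeg R U (nScales β) μ K)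
    (hL : klEngL₃ β U ≤ L) (hist : TrigPolyC4v → ℕ → Prop) (G : GeoConsts) (P : SplitConsts) (Q : EngConsts)
    {A : ℕ → ℝ}
    (hA0 : ∀ θ : ℝ, |klLocalPart L M β U μ K 0 θ - K.eval (klFermiPoint μ K θ)| ≤ A 0)
    (hA1 : ∀ θ : ℝ, |deriv (fun θ => klLocalPart L M β U μ K 0 θ - K.eval (klFermiPoint μ K θ)) θ| ≤ A 1)
    (hA2 : ∀ θ : ℝ, |iteratedDeriv 2 (fun θ => klLocalPart L M β U μ K 0 θ - K.eval (klFermiPoint μ K θ)) θ| ≤ A 2)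
    (hfitS : ∀ j ≤ 2, (if j = 0 then A 0 else 0) +
      (j.factorial : ℝ) ^ 2 * (2 * j.factorial * 1110 * 200 ^ j) *
        (if j = 0 then 2 * A 0 else (2 * π + 1) * A 1 + (if j = 2 then A 2 else 0)) *
        (4 + max 1 (((j - 1).factorial : ℝ) / (8 / 5))) ^ j ≤ twoLegBar G Q U j 0)
    {d ρ : ℝ} (hd : 0 < d)
    (hnear : ∀ K' : TrigPolyC4v, FrameOKDeg R U (klTempScaleIdx β klE0) μ K' → frameDist K K' ≤ d → ∀ θ : ℝ,
      |(klLocalPart L M β U μ K 0 θ - K.eval (klFermiPoint μ K θ)) - (klLocalPart L M β U μ K' 0 θ - K'.eval (klFermiPoint μ K' θ))| ≤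
        ρ * frameDist K K')
    (hvK' : ∀ K' : TrigPolyC4v, FrameOKDeg R U (klTempScaleIdx β klE0) μ K' → ∀ θ : ℝ,
      |klLocalPart L M β U μ K' 0 θ - K'.eval (klFermiPoint μ K' θ)| ≤ A 0)
    (hfitL : ρ ≤ lipBar G Q U 0) (hfar : 2 * A 0 ≤ lipBar G Q U 0 * d)
    (hz : ∀ k ∈ klShell L μ K 0, |klFieldStrength L M β U μ K 0 k - 1| ≤ R.cz * |U|)
    {m₁' : ℝ}
    (hm₁' : ∀ q : Momentum, |frameLevel μ K q| ≤ klScale klE0 0 →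
      ‖fderiv ℝ (evalM (symInterp L (fun p => klLocSelfEnergyRe L M β U μ K 0 p - K.eval (latticeMomentum L p)))) q‖ ≤ m₁')
    (hfit1 : m₁' + 4 / 3 * R.Gfr 1 * U ^ 2 ≤ R.cz * |U| * (cDtmin (-1.2) (-0.05) / 2)) :
    TwoLegCoreTD L M hist G P Q R β U μ K 0 := by
  have hK : FrameOK R U (nScales β) μ K := hKD.1
  obtain ⟨ha', hab, hb⟩ : (-4 : ℝ) < -1.1 ∧ (-1.1 : ℝ) ≤ -0.1 ∧ (-0.1 : ℝ) < 0 := by norm_num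
  obtain ⟨hAf, -, hADt, -, ⟨hlo, hhi⟩, -, -⟩ := frame_sizes_of_frameOK_explicit hR hc hcle hU hUle hβmin hβc hμ hK
  have hνC : ∀ k : ℕ, ContDiff ℝ 4 (klLocalPart L M β U μ K k) := fun k =>
    contDiff_klLocalPart (bandBounds ha' hab hb) hAf hADt hlo hhi L M β U k
  have hKc : ContDiff ℝ 4 fun θ => K.eval (klFermiPoint μ K θ) := contDiff_eval_klFermiPoint (bandBounds ha' hab hb) hAf hADt hlo hhi K
  have hP := klTwoLegPieceFn_eval_zero (L := L) (M := M) β U μ K (hνC 0).continuous hKc.continuous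
  have hδ : ContDiff ℝ 4 (fun θ => klLocalPart L M β U μ K 0 θ - K.eval (klFermiPoint μ K θ)) := (hνC 0).sub hKc
  have hper : Function.Periodic (fun θ => klLocalPart L M β U μ K 0 θ - K.eval (klFermiPoint μ K θ)) (2 * π) := fun θ => by
    simp only [klLocalPart_periodic β U μ K 0 θ, frameOnCurve_periodic μ K θ]
  refine ⟨⟨?_, fun j hj q => ?_⟩, ?_, ?_⟩
  · exact_mod_cast contDiff_onM_piece hP (N' := (4 : ℕ∞)) (by exact_mod_cast hδ) hper hμ
  · exact (norm_iteratedFDeriv_onM_piece_le_of_angularJets hP hδ hper hμ hA0 hA1 hA2 hj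
      (fun l hl x => norm_iteratedFDeriv_salmhoferCutoff_le_of_le_two (hl.trans hj) x) q).trans (hfitS j hj)
  · exact frameLipschitzFnTD_zero_of_profileNearFar (L := L) (M := M) hR hc hcle hU hUle hβmin hβc hμ hK hist G Q hd hnear hA0 hvK' hfitL hfar
  · exact twoLegSlopes_of_sepTubeGradient (L := L) (M := M) hR hc hcle hU hUle hβmin hβc hμ hKD hL 0 hz hm₁' hfit1

/-- **`TwoLegCoreTD hist G P Q R … K (n+1)` FROM PROFILE DATA** (named thresholds): angular jets of the increment profile `δ = ν_{n+1}(K) − ν_n(K)` with the tier-1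
fits; near increment-profile responses `ρ` + value sizes `A 0` for every capped comparison frame with history, `0 < d`, `ρ ≤ lipBar G Q U (n+1)`,
`2·A 0 ≤ lipBar G Q U (n+1)·d`; (E3d) on the shell and the gradient `m₁'` of `I_L[σ_{n+1} − K∘p]` on the shell tube with `m₁' + 4/3·Gfr₁U² ≤ cz|U|·cDtmin/2`. -/
theorem twoLegCoreTD_succ_of_profileData {R : RenConsts} (hR : ∀ j, 0 ≤ R.Gfr j) {c : ℝ} (hc : 0 < c)
    (hcle : c ≤ klCurveC3 R) {U : ℝ} (hU : 0 < U) (hUle : U ≤ klCurveU0 R) {β : ℝ} (hβmin : klBetaMin ≤ β)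
    (hβc : β ≤ Real.exp (c / U ^ 2)) {μ : ℝ} (hμ : μ ∈ klWindowC) {K : TrigPolyC4v} (hKD : FrameOKDeg R U (nScales β) μ K)
    (hL : klEngL₃ β U ≤ L) (hist : TrigPolyC4v → ℕ → Prop) (G : GeoConsts) (P : SplitConsts) (Q : EngConsts) (n : ℕ)
    {A : ℕ → ℝ}
    (hA0 : ∀ θ : ℝ, |klLocalPart L M β U μ K (n + 1) θ - klLocalPart L M β U μ K n θ| ≤ A 0)
    (hA1 : ∀ θ : ℝ, |deriv (fun θ => klLocalPart L M β U μ K (n + 1) θ - klLocalPart L M β U μ K n θ) θ| ≤ A 1)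
    (hA2 : ∀ θ : ℝ, |iteratedDeriv 2 (fun θ => klLocalPart L M β U μ K (n + 1) θ - klLocalPart L M β U μ K n θ) θ| ≤ A 2)
    (hfitS : ∀ j ≤ 2, (if j = 0 then A 0 else 0) +
      (j.factorial : ℝ) ^ 2 * (2 * j.factorial * 1110 * 200 ^ j) *
        (if j = 0 then 2 * A 0 else (2 * π + 1) * A 1 + (if j = 2 then A 2 else 0)) *
        (4 + max 1 (((j - 1).factorial : ℝ) / (8 / 5))) ^ j ≤ twoLegBar G Q U j (n + 1))
    {d ρ : ℝ} (hd : 0 < d)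
    (hnear : ∀ K' : TrigPolyC4v, FrameOKDeg R U (klTempScaleIdx β klE0) μ K' → (∀ j < n + 1, hist K' j) → frameDist K K' ≤ d → ∀ θ : ℝ,
      |(klLocalPart L M β U μ K (n + 1) θ - klLocalPart L M β U μ K n θ) -
        (klLocalPart L M β U μ K' (n + 1) θ - klLocalPart L M β U μ K' n θ)| ≤ ρ * frameDist K K')
    (hvK' : ∀ K' : TrigPolyC4v, FrameOKDeg R U (klTempScaleIdx β klE0) μ K' → (∀ j < n + 1, hist K' j) → ∀ θ : ℝ,
      |klLocalPart L M β U μ K' (n + 1) θ - klLocalPart L M β U μ K' n θ| ≤ A 0)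
    (hfitL : ρ ≤ lipBar G Q U (n + 1)) (hfar : 2 * A 0 ≤ lipBar G Q U (n + 1) * d)
    (hz : ∀ k ∈ klShell L μ K (n + 1), |klFieldStrength L M β U μ K (n + 1) k - 1| ≤ R.cz * |U|)
    {m₁' : ℝ}
    (hm₁' : ∀ q : Momentum, |frameLevel μ K q| ≤ klScale klE0 (n + 1) →
      ‖fderiv ℝ (evalM (symInterp L (fun p => klLocSelfEnergyRe L M β U μ K (n + 1) p - K.eval (latticeMomentum L p)))) q‖ ≤ m₁')
    (hfit1 : m₁' + 4 / 3 * R.Gfr 1 * U ^ 2 ≤ R.cz * |U| * (cDtmin (-1.2) (-0.05) / 2)) :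
    TwoLegCoreTD L M hist G P Q R β U μ K (n + 1) := by
  have hK : FrameOK R U (nScales β) μ K := hKD.1
  obtain ⟨ha', hab, hb⟩ : (-4 : ℝ) < -1.1 ∧ (-1.1 : ℝ) ≤ -0.1 ∧ (-0.1 : ℝ) < 0 := by norm_num
  obtain ⟨hAf, -, hADt, -, ⟨hlo, hhi⟩, -, -⟩ := frame_sizes_of_frameOK_explicit hR hc hcle hU hUle hβmin hβc hμ hK
  have hνC : ∀ k : ℕ, ContDiff ℝ 4 (klLocalPart L M β U μ K k) := fun k =>
    contDiff_klLocalPart (bandBounds ha' hab hb) hAf hADt hlo hhi L M β U k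
  have hP := klTwoLegPieceFn_eval_succ (L := L) (M := M) β U μ K n (hνC (n + 1)).continuous (hνC n).continuous
  have hδ : ContDiff ℝ 4 (fun θ => klLocalPart L M β U μ K (n + 1) θ - klLocalPart L M β U μ K n θ) := (hνC (n + 1)).sub (hνC n)
  have hper : Function.Periodic (fun θ => klLocalPart L M β U μ K (n + 1) θ - klLocalPart L M β U μ K n θ) (2 * π) := fun θ => by
    simp only [klLocalPart_periodic β U μ K (n + 1) θ, klLocalPart_periodic β U μ K n θ]
  refine ⟨⟨?_, fun j hj q => ?_⟩, ?_, ?_⟩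
  · exact_mod_cast contDiff_onM_piece hP (N' := (4 : ℕ∞)) (by exact_mod_cast hδ) hper hμ
  · exact (norm_iteratedFDeriv_onM_piece_le_of_angularJets hP hδ hper hμ hA0 hA1 hA2 hj
      (fun l hl x => norm_iteratedFDeriv_salmhoferCutoff_le_of_le_two (hl.trans hj) x) q).trans (hfitS j hj)
  · exact frameLipschitzFnTD_succ_of_profileNearFar (L := L) (M := M) hR hc hcle hU hUle hβmin hβc hμ hK hist G Q n hd hnear hA0 hvK' hfitL hfar
  · exact twoLegSlopes_of_sepTubeGradient (L := L) (M := M) hR hc hcle hU hUle hβmin hβc hμ hKD hL (n + 1) hz hm₁' hfit1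

/-- **Gen-6 stub-keyed, scale `0`, PROFILE data** (registered binders of 20236: `U ≤ klEngU₀4 P R c`, `klEngGeo5`, `klEngQ5 P R`). -/
theorem twoLegCoreTD_zero_of_profileData_stub8 (P : SplitConsts) {R : RenConsts} (hRW : R.WF2) {c : ℝ} (hc : 0 < c)
    (hcle : c ≤ klEngC₃3 P R) {U : ℝ} (hU : 0 < U) (hUle : U ≤ klEngU₀4 P R c) {β : ℝ} (hβmin : klBetaMin ≤ β)
    (hβc : β ≤ Real.exp (c / U ^ 2)) {μ : ℝ} (hμ : μ ∈ klWindowC) {K : TrigPolyC4v} (hKD : FrameOKDeg R U (nScales β) μ K)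
    (hL : klEngL₃ β U ≤ L) (hist : TrigPolyC4v → ℕ → Prop) {A : ℕ → ℝ}
    (hA0 : ∀ θ : ℝ, |klLocalPart L M β U μ K 0 θ - K.eval (klFermiPoint μ K θ)| ≤ A 0)
    (hA1 : ∀ θ : ℝ, |deriv (fun θ => klLocalPart L M β U μ K 0 θ - K.eval (klFermiPoint μ K θ)) θ| ≤ A 1)
    (hA2 : ∀ θ : ℝ, |iteratedDeriv 2 (fun θ => klLocalPart L M β U μ K 0 θ - K.eval (klFermiPoint μ K θ)) θ| ≤ A 2)
    (hfitS : ∀ j ≤ 2, (if j = 0 then A 0 else 0) +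
      (j.factorial : ℝ) ^ 2 * (2 * j.factorial * 1110 * 200 ^ j) *
        (if j = 0 then 2 * A 0 else (2 * π + 1) * A 1 + (if j = 2 then A 2 else 0)) *
        (4 + max 1 (((j - 1).factorial : ℝ) / (8 / 5))) ^ j ≤ twoLegBar klEngGeo5 (klEngQ5 P R) U j 0)
    {d ρ : ℝ} (hd : 0 < d)
    (hnear : ∀ K' : TrigPolyC4v, FrameOKDeg R U (klTempScaleIdx β klE0) μ K' → frameDist K K' ≤ d → ∀ θ : ℝ,
      |(klLocalPart L M β U μ K 0 θ - K.eval (klFermiPoint μ K θ)) - (klLocalPart L M β U μ K' 0 θ - K'.eval (klFermiPoint μ K' θ))| ≤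
        ρ * frameDist K K')
    (hvK' : ∀ K' : TrigPolyC4v, FrameOKDeg R U (klTempScaleIdx β klE0) μ K' → ∀ θ : ℝ,
      |klLocalPart L M β U μ K' 0 θ - K'.eval (klFermiPoint μ K' θ)| ≤ A 0)
    (hfitL : ρ ≤ lipBar klEngGeo5 (klEngQ5 P R) U 0) (hfar : 2 * A 0 ≤ lipBar klEngGeo5 (klEngQ5 P R) U 0 * d)
    (hz : ∀ k ∈ klShell L μ K 0, |klFieldStrength L M β U μ K 0 k - 1| ≤ R.cz * |U|)
    {m₁' : ℝ}
    (hm₁' : ∀ q : Momentum, |frameLevel μ K q| ≤ klScale klE0 0 →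
      ‖fderiv ℝ (evalM (symInterp L (fun p => klLocSelfEnergyRe L M β U μ K 0 p - K.eval (latticeMomentum L p)))) q‖ ≤ m₁')
    (hfit1 : m₁' + 4 / 3 * R.Gfr 1 * U ^ 2 ≤ R.cz * |U| * (cDtmin (-1.2) (-0.05) / 2)) :
    TwoLegCoreTD L M hist klEngGeo5 P (klEngQ5 P R) R β U μ K 0 :=
  have hR : ∀ j, 0 ≤ R.Gfr j := hRW.1.2.2
  twoLegCoreTD_zero_of_profileData (L := L) (M := M) hR hc (hcle.trans (klEngC₃3_le_klCurveC3 P hR)) hU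
    ((le_klEngU₀3_of_le_klEngU₀4 hUle).trans (klEngU₀3_le_klCurveU0 P hR c)) hβmin hβc hμ hKD hL hist klEngGeo5 P (klEngQ5 P R)
    hA0 hA1 hA2 hfitS hd hnear hvK' hfitL hfar hz hm₁' hfit1

/-- **Gen-6 stub-keyed, scale `n + 1`, PROFILE data** (registered binders of 20236). -/
theorem twoLegCoreTD_succ_of_profileData_stub8 (P : SplitConsts) {R : RenConsts} (hRW : R.WF2) {c : ℝ} (hc : 0 < c)
    (hcle : c ≤ klEngC₃3 P R) {U : ℝ} (hU : 0 < U) (hUle : U ≤ klEngU₀4 P R c) {β : ℝ} (hβmin : klBetaMin ≤ β)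
    (hβc : β ≤ Real.exp (c / U ^ 2)) {μ : ℝ} (hμ : μ ∈ klWindowC) {K : TrigPolyC4v} (hKD : FrameOKDeg R U (nScales β) μ K)
    (hL : klEngL₃ β U ≤ L) (hist : TrigPolyC4v → ℕ → Prop) (n : ℕ) {A : ℕ → ℝ}
    (hA0 : ∀ θ : ℝ, |klLocalPart L M β U μ K (n + 1) θ - klLocalPart L M β U μ K n θ| ≤ A 0)
    (hA1 : ∀ θ : ℝ, |deriv (fun θ => klLocalPart L M β U μ K (n + 1) θ - klLocalPart L M β U μ K n θ) θ| ≤ A 1)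
    (hA2 : ∀ θ : ℝ, |iteratedDeriv 2 (fun θ => klLocalPart L M β U μ K (n + 1) θ - klLocalPart L M β U μ K n θ) θ| ≤ A 2)
    (hfitS : ∀ j ≤ 2, (if j = 0 then A 0 else 0) +
      (j.factorial : ℝ) ^ 2 * (2 * j.factorial * 1110 * 200 ^ j) *
        (if j = 0 then 2 * A 0 else (2 * π + 1) * A 1 + (if j = 2 then A 2 else 0)) *
        (4 + max 1 (((j - 1).factorial : ℝ) / (8 / 5))) ^ j ≤ twoLegBar klEngGeo5 (klEngQ5 P R) U j (n + 1))
    {d ρ : ℝ} (hd : 0 < d)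
    (hnear : ∀ K' : TrigPolyC4v, FrameOKDeg R U (klTempScaleIdx β klE0) μ K' → (∀ j < n + 1, hist K' j) → frameDist K K' ≤ d → ∀ θ : ℝ,
      |(klLocalPart L M β U μ K (n + 1) θ - klLocalPart L M β U μ K n θ) -
        (klLocalPart L M β U μ K' (n + 1) θ - klLocalPart L M β U μ K' n θ)| ≤ ρ * frameDist K K')
    (hvK' : ∀ K' : TrigPolyC4v, FrameOKDeg R U (klTempScaleIdx β klE0) μ K' → (∀ j < n + 1, hist K' j) → ∀ θ : ℝ,
      |klLocalPart L M β U μ K' (n + 1) θ - klLocalPart L M β U μ K' n θ| ≤ A 0)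
    (hfitL : ρ ≤ lipBar klEngGeo5 (klEngQ5 P R) U (n + 1)) (hfar : 2 * A 0 ≤ lipBar klEngGeo5 (klEngQ5 P R) U (n + 1) * d)
    (hz : ∀ k ∈ klShell L μ K (n + 1), |klFieldStrength L M β U μ K (n + 1) k - 1| ≤ R.cz * |U|)
    {m₁' : ℝ}
    (hm₁' : ∀ q : Momentum, |frameLevel μ K q| ≤ klScale klE0 (n + 1) →
      ‖fderiv ℝ (evalM (symInterp L (fun p => klLocSelfEnergyRe L M β U μ K (n + 1) p - K.eval (latticeMomentum L p)))) q‖ ≤ m₁')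
    (hfit1 : m₁' + 4 / 3 * R.Gfr 1 * U ^ 2 ≤ R.cz * |U| * (cDtmin (-1.2) (-0.05) / 2)) :
    TwoLegCoreTD L M hist klEngGeo5 P (klEngQ5 P R) R β U μ K (n + 1) :=
  have hR : ∀ j, 0 ≤ R.Gfr j := hRW.1.2.2
  twoLegCoreTD_succ_of_profileData (L := L) (M := M) hR hc (hcle.trans (klEngC₃3_le_klCurveC3 P hR)) hU
    ((le_klEngU₀3_of_le_klEngU₀4 hUle).trans (klEngU₀3_le_klCurveU0 P hR c)) hβmin hβc hμ hKD hL hist klEngGeo5 P (klEngQ5 P R) n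
    hA0 hA1 hA2 hfitS hd hnear hvK' hfitL hfar hz hm₁' hfit1

end Summit.HubbardSuperconductivity.HubbardSuperconductivity.Theorems.KLRegimeSplit

end
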